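import Summits.QuantumFields.YangMills.Theorems.BalabanLadderIRColdDoublingRecursionSC
import HarnessLib

/-!
# The SHARP EXTENSION LEMMA: the RP bootstrap closes at every aspect `time/side < 1`; the `2:1` seed equals the `4:1` seed

Supplier ∕ format result for crux `BalabanLadder.IR` (stmt-QuantumFields-19354, rung R2c; cell ym-ir).  Provenance: ideator seat
ym-ir-idea-13 g0 (lens «control», LINE 1 `sharp-extension`, workfile `Cruxes/IR/Lines/sharp_extension.lean` 45a274437bb4 §A–§C verbatim);
critic verdict ym-ir-crit-4 g0 2026-08-28T03:02:57Z **PASS as SUPPLIER ∕ FORMAT RESULT** («LAND §A–§C as a Theorems file»); landed by the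
ideator under director-ym RULING g9-№2 (2026-08-28T03:12:58Z).  Sorry-free; NO Theses-concluding theorem; nothing datum-quantified.

HONEST FRAMING.  Nothing here proves the Yang–Mills mass gap (Clay), a lattice gap, or `BalabanLadder.IR`; R4 (`BalabanUVStability4`)
closes only the conditional finite-𝕋⁴ rung `BalabanLadder.UV`.  Everything below is model-free reflection-positivity bookkeeping in the
abstract class `IsAxisSymmetric ∧ IsTracePositive` (§A–§B) or its instantiation on the Wilson family (§C), valid for EVERY compact gauge
group at every `β ≥ 0` (U(1), SO(3) included): it carries no Yang–Mills difficulty.  The open seed `E` (`ColdExitSC`) is NOT touched —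
§C proves it EQUIVALENT to its `2:1` dress `TwoToOneExitSC` (census B-g4-1 (i) «cold-seed invariance» as a theorem).

CONTENT.  §A `slope_le_Yfun` (`n·((n'/n)φ(n,b) − φ(n',b)) ≤ Y_n(n',b)`: top-eigenvalue bound + axis symmetry `(0 3)`) and
`extension_sharp` (`Y_c(n',b₁,b₂) ≤ n'/(n−c) · Y_c(n,b₁,b₂)` for `2 ≤ c < n ≤ n'`: no tower, no volume bounds, no `L ≥ 8`, every aspect
`c/n < 1`; strictly improves `extension_le`).  §B the period-doubling defect at any time `t < L`, `aspectDefect Z L t = 1 − Z(L,L,L,2t)/Z(L,L,L,t)²`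
(`boxDefect Z L = aspectDefect Z L (L/4)` by `rfl`): `aspectDefect_extension`, `aspect_defectSquaring` (`δ^{(t')}(L') ≤ 32 (Bδe^{Bδ})²`,
`B = 2(L'/(L−t))³`), `nearAspectOne_recursion` (`t = L−1`, `B = 2L'³`).  §C (Wilson model): `twoOneDefect`, `coldDefect_le_of_twoOneDefect`,
`twoOneDefect_le_of_coldDefect`, `TwoToOneExitSC`, `coldExitSC_iff_twoToOneExitSC`.  WHERE IT STOPS (format remark B-selfdual, not a
theorem): at `c = n` (time = side; items 17753/17754) the datum bound is vacuous.

References: Luscher1977, OsterwalderSeiler1978, PrivmanFisher1983; tree `extension_step`, `defectSquaring`, `ColdExitSC`, `R_holds`.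
-/

noncomputable section
open MeasureTheory Filter
open scoped BigOperators Topology
open Literature.MathematicalPhysics.QuantumFieldTheory Literature.MathematicalPhysics.QuantumLattice
open Summit.QuantumFields.YangMills.Cruxes.IR.ColdPurityBridge (coldDefect ColdExitSC)

namespace Summit.QuantumFields.YangMills.Cruxes.IR.AspectBootstrap

/-! ## §A The sharp extension lemma (abstract class `[Sym]+[TM]`; sorry-free) -/

section Family

variable {Z : ℕ → ℕ → ℕ → ℕ → ℝ}

/-- **Casimir slope ≤ transposed excitation** (the controlling quantity; no third box, no tower): for `2 ≤ n, n'`,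
`n ((n'/n) φ(n,b) − φ(n',b)) ≤ Y_n(n',b)` — from `n' φ(n,b) ≤ log Z(n,b,n') = log Z(n',b,n)` (Sym `(0 3)`). -/
theorem slope_le_Yfun (hS : IsAxisSymmetric Z) (hT : IsTracePositive Z) {b₁ b₂ n n' : ℕ}
    (hb₁ : 2 ≤ b₁) (hb₂ : 2 ≤ b₂) (hn : 2 ≤ n) (hn' : 2 ≤ n') :
    (n : ℝ) * (((n' : ℝ) / n) * phi (Z n b₁ b₂) - phi (Z n' b₁ b₂)) ≤ Yfun (Z n' b₁ b₂) n := by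
  obtain ⟨kn, rfl⟩ : ∃ kn, n = kn + 2 := ⟨n - 2, by omega⟩
  obtain ⟨kn', rfl⟩ : ∃ kn', n' = kn' + 2 := ⟨n' - 2, by omega⟩
  have hdn : HasSpectralDatum (Z (kn + 2) b₁ b₂) := hT _ _ _ (by omega) hb₁ hb₂
  have A1 := mul_phi_le_log hdn kn'
  have A3 : Z (kn + 2) b₁ b₂ (kn' + 2) = Z (kn' + 2) b₁ b₂ (kn + 2) := (hS _ _ _ _).1
  rw [A3] at A1
  have hnpos : (0 : ℝ) < ((kn + 2 : ℕ) : ℝ) := by positivity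
  have e : ((kn + 2 : ℕ) : ℝ) * (((kn' + 2 : ℕ) : ℝ) / ((kn + 2 : ℕ) : ℝ) * phi (Z (kn + 2) b₁ b₂)) =
      ((kn' + 2 : ℕ) : ℝ) * phi (Z (kn + 2) b₁ b₂) := by
    field_simp
  unfold Yfun
  rw [mul_sub, e]
  push_cast at A1 ⊢
  linarith

/-- **SHARP EXTENSION LEMMA** (sorry-free): for `2 ≤ c < n ≤ n'` and any cross-section `(b₁,b₂)`,
`Y_c(n',b₁,b₂) ≤ (n'/(n − c)) · Y_c(n,b₁,b₂)` — the fixed-time spatial extension closes for EVERY aspect `c/n < 1`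
(no tower, no volume bounds, no `L ≥ 8`). -/
theorem extension_sharp (hS : IsAxisSymmetric Z) (hT : IsTracePositive Z) {b₁ b₂ c n n' : ℕ}
    (hb₁ : 2 ≤ b₁) (hb₂ : 2 ≤ b₂) (hc : 2 ≤ c) (hcn : c < n) (hnn' : n ≤ n') :
    Yfun (Z n' b₁ b₂) c ≤ (n' : ℝ) / ((n : ℝ) - c) * Yfun (Z n b₁ b₂) c := by
  have hn : 2 ≤ n := by omega
  have hn' : 2 ≤ n' := by omega
  have E := extension_step hS hT hb₁ hb₂ hc hn hnn'
  have S := slope_le_Yfun hS hT hb₁ hb₂ hn hn'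
  obtain ⟨kc, rfl⟩ : ∃ kc, c = kc + 2 := ⟨c - 2, by omega⟩
  obtain ⟨kn, rfl⟩ : ∃ kn, n = kn + 2 := ⟨n - 2, by omega⟩
  obtain ⟨kn', rfl⟩ : ∃ kn', n' = kn' + 2 := ⟨n' - 2, by omega⟩
  have hdn' : HasSpectralDatum (Z (kn' + 2) b₁ b₂) := hT _ _ _ hn' hb₁ hb₂
  have M := Yfun_antitone hdn' (show kc ≤ kn by omega)
  set W := Yfun (Z (kn' + 2) b₁ b₂) (kc + 2) with hW
  set V := Yfun (Z (kn + 2) b₁ b₂) (kc + 2) with hV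
  set s := ((kn' + 2 : ℕ) : ℝ) / ((kn + 2 : ℕ) : ℝ) * phi (Z (kn + 2) b₁ b₂) - phi (Z (kn' + 2) b₁ b₂) with hs
  have hnpos : (0 : ℝ) < ((kn + 2 : ℕ) : ℝ) := by positivity
  have hcpos : (0 : ℝ) ≤ ((kc + 2 : ℕ) : ℝ) := by positivity
  have hnc : (0 : ℝ) < ((kn + 2 : ℕ) : ℝ) - ((kc + 2 : ℕ) : ℝ) := by
    have : ((kc + 2 : ℕ) : ℝ) < ((kn + 2 : ℕ) : ℝ) := by exact_mod_cast hcn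
    linarith
  have S' : ((kn + 2 : ℕ) : ℝ) * s ≤ W := le_trans S M
  have E' : ((kn + 2 : ℕ) : ℝ) * W ≤ ((kn' + 2 : ℕ) : ℝ) * V + ((kc + 2 : ℕ) : ℝ) * W := by
    have h1 : ((kn + 2 : ℕ) : ℝ) * W ≤
        ((kn + 2 : ℕ) : ℝ) * (((kn' + 2 : ℕ) : ℝ) / ((kn + 2 : ℕ) : ℝ) * V + ((kc + 2 : ℕ) : ℝ) * s) :=
      mul_le_mul_of_nonneg_left E hnpos.le
    have h2 : ((kn + 2 : ℕ) : ℝ) * (((kn' + 2 : ℕ) : ℝ) / ((kn + 2 : ℕ) : ℝ) * V + ((kc + 2 : ℕ) : ℝ) * s) =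
        ((kn' + 2 : ℕ) : ℝ) * V + ((kc + 2 : ℕ) : ℝ) * (((kn + 2 : ℕ) : ℝ) * s) := by
      field_simp
    have h3 : ((kc + 2 : ℕ) : ℝ) * (((kn + 2 : ℕ) : ℝ) * s) ≤ ((kc + 2 : ℕ) : ℝ) * W :=
      mul_le_mul_of_nonneg_left S' hcpos
    linarith
  have E'' : (((kn + 2 : ℕ) : ℝ) - ((kc + 2 : ℕ) : ℝ)) * W ≤ ((kn' + 2 : ℕ) : ℝ) * V := by linarith
  rw [div_mul_eq_mul_div, le_div_iff₀ (by push_cast at hnc ⊢; linarith)]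
  push_cast at E'' ⊢
  linarith

/-- The cube version: `Y_c(L',L',L') ≤ (L'/(L−c))³ · Y_c(L,L,L)` for `2 ≤ c < L ≤ L'` (three sharp extensions, the
extended side moved to slot 0 by Sym `(0 1)`, `(0 2)`). -/
theorem cube_extension_sharp (hS : IsAxisSymmetric Z) (hT : IsTracePositive Z) {c L L' : ℕ}
    (hc : 2 ≤ c) (hcL : c < L) (hLL' : L ≤ L') :
    Yfun (Z L' L' L') c ≤ ((L' : ℝ) / ((L : ℝ) - c)) ^ 3 * Yfun (Z L L L) c := by
  have hL : 2 ≤ L := by omega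
  have hL' : 2 ≤ L' := by omega
  have e1 := extension_sharp hS hT hL hL hc hcL hLL'
  have e2 := extension_sharp hS hT hL' hL hc hcL hLL'
  have e3 := extension_sharp hS hT hL' hL' hc hcL hLL'
  have s1 : Z L' L L = Z L L' L := funext fun τ => (hS L' L L τ).2.1
  have s2 : Z L' L' L = Z L L' L' := funext fun τ => (hS L' L' L τ).2.2
  rw [s1] at e1
  rw [s2] at e2
  obtain ⟨kc, rfl⟩ : ∃ kc, c = kc + 2 := ⟨c - 2, by omega⟩
  have hq : 0 ≤ (L' : ℝ) / ((L : ℝ) - ((kc + 2 : ℕ) : ℝ)) := by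
    apply div_nonneg (by positivity)
    have : (((kc + 2 : ℕ) : ℝ)) < (L : ℝ) := by exact_mod_cast hcL
    linarith
  set q : ℝ := (L' : ℝ) / ((L : ℝ) - ((kc + 2 : ℕ) : ℝ))
  calc Yfun (Z L' L' L') (kc + 2) ≤ q * Yfun (Z L L' L') (kc + 2) := e3
    _ ≤ q * (q * Yfun (Z L L' L) (kc + 2)) := mul_le_mul_of_nonneg_left e2 hq
    _ ≤ q * (q * (q * Yfun (Z L L L) (kc + 2))) :=
        mul_le_mul_of_nonneg_left (mul_le_mul_of_nonneg_left e1 hq) hq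
    _ = q ^ 3 * Yfun (Z L L L) (kc + 2) := by ring

/-! ## §B The period-doubling defect at an arbitrary aspect (abstract; sorry-free) -/

/-- The period-doubling defect of the cube `L³` read at time `t`: `δ^{(t)}(L) = 1 − Z(L,L,L,2t)/Z(L,L,L,t)²`.
`boxDefect Z L` (aspect `4:1`) is `aspectDefect Z L (L/4)` and the model's `coldDefect`/`twoOneDefect` are its instances. -/
def aspectDefect (Z : ℕ → ℕ → ℕ → ℕ → ℝ) (L t : ℕ) : ℝ :=
  1 - Z L L L (2 * t) / Z L L L t ^ 2

/-- The landed cold defect is the aspect defect at time `⌊L/4⌋` (definitional). -/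
theorem boxDefect_eq_aspectDefect (Z : ℕ → ℕ → ℕ → ℕ → ℝ) (L : ℕ) :
    boxDefect Z L = aspectDefect Z L (L / 4) := rfl

/-- `0 ≤ δ^{(t)} ≤ 1`, `δ^{(t)} ≤ 2 x_t`, and `δ^{(t)} ≤ 1/2 ⇒ x_t ≤ 2 δ^{(t)}` (`defect_facts`). -/
theorem aspectDefect_facts (hT : IsTracePositive Z) {L t : ℕ} (hL : 2 ≤ L) (ht : 2 ≤ t) :
    0 ≤ aspectDefect Z L t ∧ aspectDefect Z L t ≤ 1 ∧ aspectDefect Z L t ≤ 2 * exc (Z L L L) t ∧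
      (aspectDefect Z L t ≤ 1 / 2 → exc (Z L L L) t ≤ 2 * aspectDefect Z L t) := by
  obtain ⟨k, rfl⟩ : ∃ k, t = k + 2 := ⟨t - 2, by omega⟩
  have hz : HasSpectralDatum (Z L L L) := hT L L L hL hL hL
  obtain ⟨h0, h1, h2, h3⟩ := defect_facts hz k
  unfold aspectDefect
  exact ⟨h0, h1, h2, fun h => h3 _ h le_rfl⟩

/-- **Fixed-time extension of the defect at ANY aspect `t < L`**: for `2 ≤ t < L ≤ L'`,
`δ^{(t)}(L') ≤ 2 (B δ) e^{B δ}` with `δ = δ^{(t)}(L)`, `B = 2 (L'/(L−t))³` (three sharp extensions + `e^y − 1 ≤ y e^y`). -/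
theorem aspectDefect_extension (hS : IsAxisSymmetric Z) (hT : IsTracePositive Z) {t L L' : ℕ}
    (ht : 2 ≤ t) (htL : t < L) (hLL' : L ≤ L') :
    aspectDefect Z L' t ≤
      2 * ((2 * ((L' : ℝ) / ((L : ℝ) - t)) ^ 3) * aspectDefect Z L t) *
        Real.exp ((2 * ((L' : ℝ) / ((L : ℝ) - t)) ^ 3) * aspectDefect Z L t) := by
  have hL : 2 ≤ L := by omega
  have hL' : 2 ≤ L' := by omega
  obtain ⟨hδ0, -, -, hxδ⟩ := aspectDefect_facts hT hL ht
  obtain ⟨-, hδ'1, hδ'x, -⟩ := aspectDefect_facts hT hL' ht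
  have hY' := cube_extension_sharp hS hT ht htL hLL'
  obtain ⟨k, rfl⟩ : ∃ k, t = k + 2 := ⟨t - 2, by omega⟩
  have hz : HasSpectralDatum (Z L L L) := hT L L L hL hL hL
  have hz' : HasSpectralDatum (Z L' L' L') := hT L' L' L' hL' hL' hL'
  set q : ℝ := (L' : ℝ) / ((L : ℝ) - ((k + 2 : ℕ) : ℝ)) with hq
  set B : ℝ := 2 * q ^ 3 with hB
  set δ : ℝ := aspectDefect Z L (k + 2) with hδ
  set δ' : ℝ := aspectDefect Z L' (k + 2) with hδ'
  have htL' : ((k + 2 : ℕ) : ℝ) < (L : ℝ) := by exact_mod_cast htL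
  have hden : 0 < (L : ℝ) - ((k + 2 : ℕ) : ℝ) := by linarith
  have hq1 : 1 ≤ q := by
    rw [hq, le_div_iff₀ hden]
    have : (L : ℝ) ≤ L' := by exact_mod_cast hLL'
    have : (0 : ℝ) ≤ ((k + 2 : ℕ) : ℝ) := by positivity
    linarith
  have hq0 : 0 ≤ q := le_trans zero_le_one hq1
  have hq3 : 1 ≤ q ^ 3 := one_le_pow₀ hq1
  have hB2 : 2 ≤ B := by rw [hB]; linarith
  by_cases hhalf : 1 / 2 < δ
  · have h1 : 1 ≤ B * δ := by nlinarith
    have h2 : 1 ≤ Real.exp (B * δ) := Real.one_le_exp (by positivity)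
    calc δ' ≤ 1 := hδ'1
      _ ≤ 2 * (B * δ) * Real.exp (B * δ) := by nlinarith
  push Not at hhalf
  have hx : exc (Z L L L) (k + 2) ≤ 2 * δ := hxδ hhalf
  have hy : Yfun (Z L L L) (k + 2) ≤ 2 * δ := (Yfun_le_exc hz k).trans hx
  have hY'' : Yfun (Z L' L' L') (k + 2) ≤ B * δ := by
    have := mul_le_mul_of_nonneg_left hy (le_trans zero_le_one hq3)
    calc Yfun (Z L' L' L') (k + 2) ≤ q ^ 3 * Yfun (Z L L L) (k + 2) := hY'
      _ ≤ q ^ 3 * (2 * δ) := this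
      _ = B * δ := by rw [hB]; ring
  have hx' : exc (Z L' L' L') (k + 2) ≤ Real.exp (B * δ) - 1 := by
    rw [exc_eq_exp_Yfun hz' k]
    linarith [Real.exp_le_exp.2 hY'']
  have hu : Real.exp (B * δ) - 1 ≤ B * δ * Real.exp (B * δ) := Literature.Analysis.ODE.exp_sub_one_le_mul_exp _
  calc δ' ≤ 2 * exc (Z L' L' L') (k + 2) := hδ'x
    _ ≤ 2 * (Real.exp (B * δ) - 1) := by linarith
    _ ≤ 2 * (B * δ) * Real.exp (B * δ) := by linarith

/-- **Lengthening the time squares the defect**: for `2 ≤ t`, `2t ≤ t'`: `δ^{(t')}(L) ≤ 8 (δ^{(t)}(L))²`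
(`x_{t'} ≤ x_{2t} ≤ x_t²`, ℓᵖ-monotonicity of the spectrum). -/
theorem aspectDefect_of_two_mul_le (hT : IsTracePositive Z) {L t t' : ℕ} (hL : 2 ≤ L) (ht : 2 ≤ t)
    (htt' : 2 * t ≤ t') : aspectDefect Z L t' ≤ 8 * aspectDefect Z L t ^ 2 := by
  obtain ⟨hδ0, -, -, hxδ⟩ := aspectDefect_facts hT hL ht
  obtain ⟨-, hδ'1, hδ'x, -⟩ := aspectDefect_facts hT hL (t := t') (by omega)
  obtain ⟨k, rfl⟩ : ∃ k, t = k + 2 := ⟨t - 2, by omega⟩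
  obtain ⟨k', rfl⟩ : ∃ k', t' = k' + 2 := ⟨t' - 2, by omega⟩
  have hz : HasSpectralDatum (Z L L L) := hT L L L hL hL hL
  set δ : ℝ := aspectDefect Z L (k + 2)
  set δ' : ℝ := aspectDefect Z L (k' + 2)
  by_cases hhalf : 1 / 2 < δ
  · nlinarith
  push Not at hhalf
  have hx : exc (Z L L L) (k + 2) ≤ 2 * δ := hxδ hhalf
  have hx0 : 0 ≤ exc (Z L L L) (k + 2) := exc_nonneg hz k
  have hxT : exc (Z L L L) (k' + 2) ≤ exc (Z L L L) (k + 2) ^ 2 :=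
    calc exc (Z L L L) (k' + 2) ≤ exc (Z L L L) (2 * k + 2 + 2) := exc_antitone hz (by omega)
      _ = exc (Z L L L) (2 * (k + 2)) := by ring_nf
      _ ≤ exc (Z L L L) (k + 2) ^ 2 := exc_two_mul_le_sq hz k
  calc δ' ≤ 2 * exc (Z L L L) (k' + 2) := hδ'x
    _ ≤ 2 * exc (Z L L L) (k + 2) ^ 2 := by linarith
    _ ≤ 2 * (2 * δ) ^ 2 := by gcongr
    _ = 8 * δ ^ 2 := by ring

/-- **GENERAL-ASPECT SQUARING** (sorry-free): for `2 ≤ t < L ≤ L'` and `2t ≤ t'`,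
`δ^{(t')}(L') ≤ 32 (B δ e^{Bδ})²`, `δ = δ^{(t)}(L)`, `B = 2 (L'/(L−t))³`.  At `t = ⌊L/4⌋`, `t' = ⌊L'/4⌋`, `L' ∈ [2L,4L]`
this is the landed `defectSquaring` without `[Vol]`/`L ≥ 8` (`B ≤ 2(16/3)³`); at `t = ⌊L/2⌋` (aspect `2:1`) `B ≤ 1024`;
at `t = L − 1` see `nearAspectOne_recursion`. -/
theorem aspect_defectSquaring (hS : IsAxisSymmetric Z) (hT : IsTracePositive Z) {t L L' t' : ℕ}
    (ht : 2 ≤ t) (htL : t < L) (hLL' : L ≤ L') (htt' : 2 * t ≤ t') :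
    aspectDefect Z L' t' ≤
      32 * (((2 * ((L' : ℝ) / ((L : ℝ) - t)) ^ 3) * aspectDefect Z L t) *
        Real.exp ((2 * ((L' : ℝ) / ((L : ℝ) - t)) ^ 3) * aspectDefect Z L t)) ^ 2 := by
  have hL' : 2 ≤ L' := by omega
  have h1 := aspectDefect_extension hS hT ht htL hLL'
  have h2 := aspectDefect_of_two_mul_le hT (L := L') hL' ht htt'
  have h0 : 0 ≤ aspectDefect Z L' t := (aspectDefect_facts hT hL' ht).1
  set a := aspectDefect Z L' t
  set M := ((2 * ((L' : ℝ) / ((L : ℝ) - t)) ^ 3) * aspectDefect Z L t) *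
        Real.exp ((2 * ((L' : ℝ) / ((L : ℝ) - t)) ^ 3) * aspectDefect Z L t)
  have h1' : a ≤ 2 * M := by linarith
  have h3 : a ^ 2 ≤ (2 * M) ^ 2 := pow_le_pow_left₀ h0 h1' 2
  calc aspectDefect Z L' t' ≤ 8 * a ^ 2 := h2
    _ ≤ 8 * (2 * M) ^ 2 := by linarith
    _ = 32 * M ^ 2 := by ring

/-- **17754 territory — the near-aspect-1 recursion, for every RP model** (sorry-free): with
`δ♮(L) := δ^{(L−1)}(L) = 1 − Z(L,L,L,2L−2)/Z(L,L,L,L−1)²` (one time layer short of item 17754's `δ₁`),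
for `3 ≤ L`, `L' ∈ [2L, 4L]`: `δ♮(L') ≤ 32 (2L'³ δ♮(L) e^{2L'³ δ♮(L)})²` — squaring with a POLYNOMIAL constant.
(Item 17754 verbatim, time `= side`, is the self-dual point and is NOT reached: see the module docstring.) -/
theorem nearAspectOne_recursion (hS : IsAxisSymmetric Z) (hT : IsTracePositive Z) {L L' : ℕ}
    (hL : 3 ≤ L) (h₁ : 2 * L ≤ L') (h₂ : L' ≤ 4 * L) :
    aspectDefect Z L' (L' - 1) ≤
      32 * ((2 * (L' : ℝ) ^ 3 * aspectDefect Z L (L - 1)) *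
        Real.exp (2 * (L' : ℝ) ^ 3 * aspectDefect Z L (L - 1))) ^ 2 := by
  have key := aspect_defectSquaring hS hT (t := L - 1) (L := L) (L' := L') (t' := L' - 1)
    (by omega) (by omega) (by omega) (by omega)
  have hc : ((L - 1 : ℕ) : ℝ) = (L : ℝ) - 1 := by
    rw [Nat.cast_sub (by omega)]; push_cast; ring
  have hq : (L' : ℝ) / ((L : ℝ) - ((L - 1 : ℕ) : ℝ)) = L' := by
    rw [hc]; ring_nf
  rw [hq] at key
  exact key

end Family

/-! ## §C The model: the `2:1` seed is equivalent to the `4:1` seed (sorry-free) -/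

section Model

variable {G : Type} [Group G] [TopologicalSpace G] [IsTopologicalGroup G] [CompactSpace G]
  [MeasurableSpace G] [BorelSpace G]

/-- The **`2:1` period-doubling defect** `δ₂,β(L) = 1 − Z_β(L,L,L,2⌊L/2⌋)/Z_β(L,L,L,⌊L/2⌋)²` (this line's INSTRUMENT:
tori `L³ × ⌊L/2⌋`, `L³ × 2⌊L/2⌋`). -/
def twoOneDefect {N : ℕ} (ρ : G →* Matrix (Fin N) (Fin N) ℂ) (β : ℝ) (L : ℕ) : ℝ :=
  1 - wilsonFinTorusPartition ρ β L L L (2 * (L / 2)) / wilsonFinTorusPartition ρ β L L L (L / 2) ^ 2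

/-- `twoOneDefect` is the aspect defect at time `⌊L/2⌋` (definitional). -/
theorem twoOneDefect_eq {N : ℕ} (ρ : G →* Matrix (Fin N) (Fin N) ℂ) (β : ℝ) (L : ℕ) :
    twoOneDefect ρ β L = aspectDefect (wilsonFinTorusPartition ρ β) L (L / 2) := rfl

/-- `ColdPurityBridge.coldDefect` is the aspect defect at time `⌊L/4⌋` (definitional). -/
theorem coldDefect_eq_aspectDefect {N : ℕ} (ρ : G →* Matrix (Fin N) (Fin N) ℂ) (β : ℝ) (L : ℕ) :
    coldDefect ρ β L = aspectDefect (wilsonFinTorusPartition ρ β) L (L / 4) := rfl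

/-- **`2:1`-purity at `L` ⇒ `4:1`-purity at `4⌊L/2⌋`** (sharp extension at aspect `θ = 1/2`, `B ≤ 128`):
`δᶜ_β(4⌊L/2⌋) ≤ 256 δ₂,β(L) e^{128 δ₂,β(L)}` for `β ≥ 0`, `L ≥ 4`. -/
theorem coldDefect_le_of_twoOneDefect (r : LatticeRep G) {β : ℝ} (hβ : 0 ≤ β) {L : ℕ} (hL : 4 ≤ L) :
    coldDefect r.ρ β (4 * (L / 2)) ≤ 2 * (128 * twoOneDefect r.ρ β L) * Real.exp (128 * twoOneDefect r.ρ β L) := by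
  have hS := axisSymmetric r β
  have hT := tracePositive r hβ
  have ht2 : 2 ≤ L / 2 := by omega
  have htL : L / 2 < L := by omega
  have hL4t : L ≤ 4 * (L / 2) := by omega
  have h44 : 4 * (L / 2) / 4 = L / 2 := by omega
  have key := aspectDefect_extension hS hT ht2 htL hL4t
  rw [coldDefect_eq_aspectDefect, h44, twoOneDefect_eq]
  set δ := aspectDefect (wilsonFinTorusPartition r.ρ β) L (L / 2) with hδ
  have hδ0 : 0 ≤ δ := (aspectDefect_facts hT (L := L) (t := L / 2) (by omega) ht2).1
  have htr : (((L / 2 : ℕ) : ℝ)) < (L : ℝ) := by exact_mod_cast htL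
  have hden : 0 < (L : ℝ) - ((L / 2 : ℕ) : ℝ) := by linarith
  have h2t : (((2 * (L / 2) : ℕ)) : ℝ) ≤ (L : ℝ) := by exact_mod_cast (Nat.mul_div_le L 2)
  have hq4 : (((4 * (L / 2) : ℕ)) : ℝ) / ((L : ℝ) - ((L / 2 : ℕ) : ℝ)) ≤ 4 := by
    rw [div_le_iff₀ hden]
    push_cast at h2t ⊢
    linarith
  have hq0 : 0 ≤ (((4 * (L / 2) : ℕ)) : ℝ) / ((L : ℝ) - ((L / 2 : ℕ) : ℝ)) := div_nonneg (by positivity) hden.le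
  have hB : 2 * ((((4 * (L / 2) : ℕ)) : ℝ) / ((L : ℝ) - ((L / 2 : ℕ) : ℝ))) ^ 3 ≤ 128 := by
    have : ((((4 * (L / 2) : ℕ)) : ℝ) / ((L : ℝ) - ((L / 2 : ℕ) : ℝ))) ^ 3 ≤ 4 ^ 3 :=
      pow_le_pow_left₀ hq0 hq4 3
    linarith
  have hB0 : 0 ≤ 2 * ((((4 * (L / 2) : ℕ)) : ℝ) / ((L : ℝ) - ((L / 2 : ℕ) : ℝ))) ^ 3 := by positivity
  set B := 2 * ((((4 * (L / 2) : ℕ)) : ℝ) / ((L : ℝ) - ((L / 2 : ℕ) : ℝ))) ^ 3 with hBdef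
  calc aspectDefect (wilsonFinTorusPartition r.ρ β) (4 * (L / 2)) (L / 2)
        ≤ 2 * (B * δ) * Real.exp (B * δ) := key
    _ ≤ 2 * (128 * δ) * Real.exp (128 * δ) := by gcongr

/-- The converse, **`4:1`-purity ⇒ `2:1`-purity at the same `L`**: `δ₂,β(L) ≤ 8 δᶜ_β(L)²` (`β ≥ 0`, `L ≥ 8`). -/
theorem twoOneDefect_le_of_coldDefect (r : LatticeRep G) {β : ℝ} (hβ : 0 ≤ β) {L : ℕ} (hL : 8 ≤ L) :
    twoOneDefect r.ρ β L ≤ 8 * coldDefect r.ρ β L ^ 2 := by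
  rw [coldDefect_eq_aspectDefect, twoOneDefect_eq]
  exact aspectDefect_of_two_mul_le (tracePositive r hβ) (L := L) (t := L / 4) (t' := L / 2)
    (by omega) (by omega) (by omega)

end Model

/-- **E₂ — `TwoToOneExitSC`: one `2:1`-pure torus per weak coupling** (compact simple simply-connected `G`, every lattice rep `r`:
`∀ ε > 0 ∃ β₁ ∀ β ≥ β₁ ∀ L₀ ∃ L ≥ L₀, δ₂,β(L) ≤ ε`).  PROVED EQUIVALENT to `ColdPurityBridge.ColdExitSC` (`coldExitSC_iff_twoToOneExitSC`;
census B-g4-1 (i)).  Why it might fail: exactly as `E` (`U(1)₄` photon gas, `SO(3)` light flux fail it; a proof must use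
non-abelianness and `π₁ = 1`).  Sources: Luscher1977, OsterwalderSeilerAnnPhys1978, `Literature.Barriers.QuantumFields.AbelianMasslessPhaseD4`. -/
def TwoToOneExitSC : Prop :=
  ∀ (G : Type) [Group G] [TopologicalSpace G] [IsTopologicalGroup G] [CompactSpace G],
    IsCompactSimpleLieGroup G → SimplyConnectedSpace G →
    letI : MeasurableSpace G := borel G
    haveI : BorelSpace G := ⟨rfl⟩
    ∀ r : LatticeRep G, ∀ ε : ℝ, 0 < ε → ∃ β₁ : ℝ, ∀ β : ℝ, β₁ ≤ β →
      ∀ L₀ : ℕ, ∃ L : ℕ, L₀ ≤ L ∧ twoOneDefect r.ρ β L ≤ ε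

/-- **E₂ ⇒ E** (real proof): a `2:1`-pure box at `L` gives a `4:1`-pure box at `4⌊L/2⌋` by the sharp extension. -/
theorem coldExitSC_of_twoToOneExitSC (hE : TwoToOneExitSC) : ColdExitSC := by
  intro G _ _ _ _ hG hsc
  letI : MeasurableSpace G := borel G
  haveI : BorelSpace G := ⟨rfl⟩
  intro r ε hε
  obtain ⟨β₁, hβ₁⟩ := hE G hG hsc r (min (1 / 256) (ε / 512)) (by positivity)
  refine ⟨max β₁ 0, fun β hβ L₀ => ?_⟩
  have hβ1 : β₁ ≤ β := le_trans (le_max_left _ _) hβ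
  have hβ0 : 0 ≤ β := le_trans (le_max_right _ _) hβ
  obtain ⟨L, hL, hδ⟩ := hβ₁ β hβ1 (max L₀ 4)
  refine ⟨4 * (L / 2), by omega, ?_⟩
  have h := coldDefect_le_of_twoOneDefect r hβ0 (L := L) (by omega)
  set δ := twoOneDefect r.ρ β L with hδdef
  have hδ0 : 0 ≤ δ := by
    rw [hδdef, twoOneDefect_eq]
    exact (aspectDefect_facts (tracePositive r hβ0) (L := L) (t := L / 2) (by omega) (by omega)).1
  have hδa : δ ≤ 1 / 256 := hδ.trans (min_le_left _ _)
  have hδb : δ ≤ ε / 512 := hδ.trans (min_le_right _ _)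
  have hE1 : Real.exp (128 * δ) * (1 - 128 * δ) ≤ 1 := by
    have h1 := Real.add_one_le_exp (-(128 * δ))
    have h2 := mul_le_mul_of_nonneg_left h1 (Real.exp_pos (128 * δ)).le
    rw [← Real.exp_add, add_neg_cancel, Real.exp_zero] at h2
    linarith
  have hE2 : Real.exp (128 * δ) ≤ 2 := by nlinarith [Real.exp_pos (128 * δ)]
  calc coldDefect r.ρ β (4 * (L / 2)) ≤ 2 * (128 * δ) * Real.exp (128 * δ) := h
    _ ≤ 2 * (128 * δ) * 2 := by gcongr
    _ = 512 * δ := by ring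
    _ ≤ ε := by linarith

/-- **E ⇒ E₂** (real proof): `δ₂(L) ≤ 8 δᶜ(L)²`. -/
theorem twoToOneExitSC_of_coldExitSC (hE : ColdExitSC) : TwoToOneExitSC := by
  intro G _ _ _ _ hG hsc
  letI : MeasurableSpace G := borel G
  haveI : BorelSpace G := ⟨rfl⟩
  intro r ε hε
  obtain ⟨β₁, hβ₁⟩ := hE G hG hsc r (min 1 (ε / 8)) (by positivity)
  refine ⟨max β₁ 0, fun β hβ L₀ => ?_⟩
  have hβ1 : β₁ ≤ β := le_trans (le_max_left _ _) hβ
  have hβ0 : 0 ≤ β := le_trans (le_max_right _ _) hβ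
  obtain ⟨L, hL, hδ⟩ := hβ₁ β hβ1 (max L₀ 8)
  refine ⟨L, by omega, ?_⟩
  have h := twoOneDefect_le_of_coldDefect r hβ0 (L := L) (by omega)
  set δ := coldDefect r.ρ β L with hδdef
  have hδ0 : 0 ≤ δ := by
    rw [hδdef, coldDefect_eq_aspectDefect]
    exact (aspectDefect_facts (tracePositive r hβ0) (L := L) (t := L / 4) (by omega) (by omega)).1
  have hδa : δ ≤ 1 := hδ.trans (min_le_left _ _)
  have hδb : δ ≤ ε / 8 := hδ.trans (min_le_right _ _)
  calc twoOneDefect r.ρ β L ≤ 8 * δ ^ 2 := h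
    _ ≤ 8 * (δ * 1) := by nlinarith
    _ ≤ ε := by linarith

/-- **The seed is aspect-independent**: `ColdExitSC ↔ TwoToOneExitSC`. -/
theorem coldExitSC_iff_twoToOneExitSC : ColdExitSC ↔ TwoToOneExitSC :=
  ⟨twoToOneExitSC_of_coldExitSC, coldExitSC_of_twoToOneExitSC⟩

end Summit.QuantumFields.YangMills.Cruxes.IR.AspectBootstrap

end
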